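import Summits.NavierStokesRegularity.FunctionalMining.TopEigColumnCharge
import Summits.NavierStokesRegularity.FunctionalMining.TopEigFrameDeriv
import HarnessLib

/-!
# FunctionalMining — Lemma L-λ, brick (ii) on the torus: the top projector field `P₁ = e₁ ⊗ e₁` of
# the strain and the size of its derivative at a simple point,
# `∑ᵢⱼ (∂ₖ(P₁)ᵢⱼ)² = 2 ∑_{a≠a₀} (u_aᵀ S(∂ₖv) u₀)² / (λ₁ − κ_a)²`

Search for candidate a priori estimates; no regularity claim. Cell `pub-nsfunc`, prove seat
(gen 25). Step (ii) of the kernel plan for the dictionary's node `TopEigGapCoerciveTwo η`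
(Proposition L-λ(η) of the no-go seat; prove seat HANDOFF GEN 25, DERIVATIVES §46): the SIGN-FREE
spectral projector of the top strain eigenvalue as a GLOBAL field on `T³`,
`topProj v x := u₀(x) ⊗ u₀(x)` (`u₀(x)` the eigenbasis vector of index `topIndex v x`; on
`U_s = {λ₂ < λ₁}` every unit top vector `f` has `f ⊗ f = topProj v x`), and its partial derivatives
at a point of `U_s` in the eigenframe:

* `topVec`, `topProj`, `topVec_dotProduct_self`, `mulVec_topVec`, `topVec_mem_topEigSet`;
* **`hasDerivAt_topProj_coordLine`** — along the coordinate line `t ↦ x + t eₖ` through `x ∈ U_s`,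
  `t ↦ (topProj v (x + t eₖ))ᵢⱼ` is differentiable at `0` with derivative `N′ᵢ eⱼ + eᵢ N′ⱼ`, where
  `e = u₀(x)` and `N′` is the derivative of the continued unit top eigenvector (Kato; tree
  `hasDerivAt_top_eigenpair`, `eventually_top_eigenpair`), with `N′ ⊥ e` and
  `|N′|² = ∑_{a≠a₀}(u_aᵀS(∂ₖv)(x)u₀)²/(λ₁(x) − κ_a)²` (`TopEigFrameDeriv`);
* **`sum_sq_partialDeriv_topProj_eq`** — `∑ᵢⱼ (∂ₖ (topProj v · i j) x)² =
  2∑_{a≠a₀}(u_aᵀS(∂ₖv)(x)u₀)²/(λ₁(x) − κ_a)²`;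
* **`sum_sq_partialDeriv_topProj_le_of_gap`** — if moreover `λ₁(x) − κ_a ≥ γ > 0` for `a ≠ a₀`
  (on the gap class `λ₂ ≤ (1−η)λ₁`: `γ = ηλ₁(x)`), then
  `∑ᵢⱼ (∂ₖ (topProj v · i j) x)² ≤ 2γ⁻² ∑_{a≠a₀}(u_aᵀS(∂ₖv)u₀)² ≤ 2γ⁻² |S(∂ₖv)(x)u₀|²`
  — controlled by the `e₁`-column of `∇S`, which the heat price charges (`TopEigColumnCharge`).

What remains for L-λ(η) (steps (iii)–(iv)): Poincaré for `λ₁·topProj` with `∫S = 0`, and the zeros of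
`S`. Nothing about L-λ itself is claimed here. [ours; folklore — Kato II-§5, first-order perturbation]
-/

noncomputable section

open Filter Topology Matrix Finset
open scoped ContDiff

namespace Summit.NavierStokesRegularity.FunctionalMining

open Literature.Analysis Literature.Analysis.FunctionSpaces Literature.Analysis.FunctionSpaces.Torus
  SharpClass.DirectorForm Literature.Analysis.Matrix

namespace TopEig

variable {v : UnitAddTorus (Fin 3) → EuclideanSpace ℝ (Fin 3)}

/-! ## 1. The global sign-free top projector -/

/-- The eigenbasis top vector `u₀(x)` (index `topIndex v x`; a sign/choice is involved, the projector
below is choice-free on `U_s`). [ours, bookkeeping] -/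
def topVec (v : UnitAddTorus (Fin 3) → EuclideanSpace ℝ (Fin 3)) (x : UnitAddTorus (Fin 3)) : Fin 3 → ℝ :=
  ((torusStrainMatrix_isHermitian v x).eigenvectorBasis (topIndex v x)).ofLp

/-- **The top spectral projector field `P₁(x) = u₀(x) ⊗ u₀(x)`.** [ours, bookkeeping] -/
def topProj (v : UnitAddTorus (Fin 3) → EuclideanSpace ℝ (Fin 3)) (x : UnitAddTorus (Fin 3)) :
    Matrix (Fin 3) (Fin 3) ℝ :=
  Matrix.vecMulVec (topVec v x) (topVec v x)

/-- `|u₀(x)| = 1`. [ours, bookkeeping] -/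
theorem topVec_dotProduct_self (v : UnitAddTorus (Fin 3) → EuclideanSpace ℝ (Fin 3))
    (x : UnitAddTorus (Fin 3)) : topVec v x ⬝ᵥ topVec v x = 1 := by
  unfold topVec
  rw [KyFan.eigenvectorBasis_dotProduct, if_pos rfl]

/-- `S(v)(x) u₀(x) = λ₁(x) u₀(x)`. [ours, bookkeeping] -/
theorem mulVec_topVec (v : UnitAddTorus (Fin 3) → EuclideanSpace ℝ (Fin 3)) (x : UnitAddTorus (Fin 3)) :
    torusStrainMatrix v x *ᵥ topVec v x = torusStrainTopEig v x • topVec v x := by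
  unfold topVec
  rw [(torusStrainMatrix_isHermitian v x).mulVec_eigenvectorBasis, eigenvalues_topIndex]

/-- `u₀(x)` is a unit top vector: `u₀(x) ∈ E(S(v)(x))`. [ours, bookkeeping] -/
theorem topVec_mem_topEigSet (v : UnitAddTorus (Fin 3) → EuclideanSpace ℝ (Fin 3))
    (x : UnitAddTorus (Fin 3)) : topVec v x ∈ topEigSet (flat (torusStrainMatrix v x)) := by
  refine ⟨topVec_dotProduct_self v x, ?_⟩
  rw [quad_flat, mulVec_topVec, dotProduct_smul, topVec_dotProduct_self, smul_eq_mul, mul_one]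
  exact (lam1_torusStrainMatrix v x).symm

/-- `(±c) ⊗ (±c) = c ⊗ c`. [folklore] -/
theorem vecMulVec_eq_of_mem_pair {c f : Fin 3 → ℝ} (hf : f ∈ ({c, -c} : Set (Fin 3 → ℝ))) :
    Matrix.vecMulVec f f = Matrix.vecMulVec c c := by
  simp only [Set.mem_insert_iff, Set.mem_singleton_iff] at hf
  rcases hf with hf | hf
  · rw [hf]
  · rw [hf]; ext i j; simp [Matrix.vecMulVec_apply]

/-! ## 2. The derivative of `topProj` along a coordinate line through a simple point -/

/-- **THE PROJECTOR ALONG A COORDINATE LINE THROUGH A SIMPLE POINT.** For `v` smooth on `T³`, `x` with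
`λ₂(x) < λ₁(x)`, a basis index `a₀` with `κ_{a₀} = λ₁(x)` (`e := u_{a₀}`) and a direction `k`, there
is `N′ ∈ ℝ³` (the derivative at `0` of the continued unit top eigenvector along `t ↦ x + t eₖ`) with:
every entry `t ↦ (topProj v (x + t eₖ))ᵢⱼ` has derivative `N′ᵢ eⱼ + eᵢ N′ⱼ` at `t = 0`; `N′ ⊥ e`; and
`|N′|² = ∑_{a≠a₀}(u_aᵀS(∂ₖv)(x)e)²/(λ₁(x) − κ_a)²`. [ours; Kato II-§5 / F1 PART I Prop. 3] -/
theorem hasDerivAt_topProj_coordLine (hv : Torus.IsSmooth v)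
    {x : UnitAddTorus (Fin 3)} (hx : torusStrainMidEig v x < torusStrainTopEig v x) {a₀ : Fin 3}
    (ha₀ : (torusStrainMatrix_isHermitian v x).eigenvalues a₀ = torusStrainTopEig v x) (k : Fin 3) :
    ∃ N' : Fin 3 → ℝ,
      (∀ i j, HasDerivAt
        (fun t : ℝ => topProj v (x + proj (t • EuclideanSpace.single k (1 : ℝ))) i j)
        (N' i * ((torusStrainMatrix_isHermitian v x).eigenvectorBasis a₀).ofLp j +
          ((torusStrainMatrix_isHermitian v x).eigenvectorBasis a₀).ofLp i * N' j) (0 : ℝ)) ∧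
      N' ⬝ᵥ ((torusStrainMatrix_isHermitian v x).eigenvectorBasis a₀).ofLp = 0 ∧
      N' ⬝ᵥ N' = ∑ a ∈ Finset.univ.erase a₀,
        ((((torusStrainMatrix_isHermitian v x).eigenvectorBasis a).ofLp ⬝ᵥ
            (torusStrainMatrix (Torus.partialDeriv k v) x *ᵥ
              ((torusStrainMatrix_isHermitian v x).eigenvectorBasis a₀).ofLp)) /
          (torusStrainTopEig v x - (torusStrainMatrix_isHermitian v x).eigenvalues a)) ^ 2 := by
  obtain ⟨he1, hSe, hgap⟩ := gapForm_eigenvectorBasis hx ha₀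
  set e : Fin 3 → ℝ := ((torusStrainMatrix_isHermitian v x).eigenvectorBasis a₀).ofLp with hedef
  have hg : 0 < torusStrainTopEig v x - torusStrainMidEig v x := sub_pos.2 hx
  set K : EuclideanSpace ℝ (Fin 3) := EuclideanSpace.single k (1 : ℝ) with hK
  -- the family along the coordinate line
  set L : ℝ → Matrix (Fin 3) (Fin 3) ℝ := fun t => torusStrainMatrix v (x + proj (t • K)) with hL
  have hLs : ∀ i j, ContDiff ℝ ∞ fun t => L t i j := fun i j =>
    contDiff_coordLine (isSmooth_torusStrainMatrix_entry hv i j) x K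
  have hLsymm : ∀ t, (L t).IsSymm := fun t => torusStrainMatrix_isSymm v _
  have hL0 : L 0 = torusStrainMatrix v x := by simp only [hL, coordLine_zero]
  have hSe' : L 0 *ᵥ e = torusStrainTopEig v x • e := by rw [hL0]; exact hSe
  have hgap' : ∀ w, w ⬝ᵥ e = 0 → w ⬝ᵥ L 0 *ᵥ w ≤
      (torusStrainTopEig v x - (torusStrainTopEig v x - torusStrainMidEig v x)) * (w ⬝ᵥ w) := by
    intro w hw; rw [hL0]; exact hgap w hw
  obtain ⟨N, Λ, hN, hΛ, hN0, hΛ0, hev, -, -, -, -⟩ :=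
    hasDerivAt_top_eigenpair hLs hLsymm he1 hSe' hg hgap'
  have hpers := eventually_top_eigenpair hLs hLsymm he1 hSe' hg hgap' hN hΛ hN0 hΛ0 hev
  -- differentiability of the components of `N` at `0`
  have hN1 : ContDiffAt ℝ 1 N 0 := hN.of_le (by simp)
  have hNev : ∀ᶠ t in 𝓝 (0 : ℝ), ∀ i, DifferentiableAt ℝ (fun s => N s i) t := by
    filter_upwards [hN1.eventually (by simp)] with t ht
    intro i
    exact (differentiableAt_pi.1 (ht.differentiableAt (by simp))) i
  set N' : Fin 3 → ℝ := fun i => deriv (fun t => N t i) 0 with hN'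
  have hN0' : ∀ i, HasDerivAt (fun t => N t i) (N' i) 0 := fun i => (hNev.self_of_nhds i).hasDerivAt
  have heig : ∀ᶠ θ in 𝓝 (0 : ℝ), L θ *ᵥ N θ = Λ θ • N θ := hev.mono fun θ h => h.1
  have hunit : ∀ᶠ θ in 𝓝 (0 : ℝ), N θ ⬝ᵥ N θ = 1 := hev.mono fun θ h => h.2
  -- along the line, `topProj = N ⊗ N` eventually (the top eigen-set is `{±N θ}`)
  have hP : ∀ᶠ θ in 𝓝 (0 : ℝ), topProj v (x + proj (θ • K)) = Matrix.vecMulVec (N θ) (N θ) := by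
    filter_upwards [hev, hpers] with θ hθ hpθ
    obtain ⟨h1, h2⟩ := hθ
    obtain ⟨-, -, h4⟩ := hpθ
    have hN1' : N θ ∈ unitSphere (Fin 3) := h2
    have hquad : quad (flat (L θ)) (N θ) = Λ θ := by
      rw [quad_flat, h1, dotProduct_smul, h2, smul_eq_mul, mul_one]
    have hpair := topEigSet_eq_pair_of_gapForm hN1' (half_pos hg)
      (gapForm_of_eigenvector (hLsymm θ) hN1' h1 h4) hquad
    have hmem : topVec v (x + proj (θ • K)) ∈ topEigSet (flat (L θ)) := topVec_mem_topEigSet v _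
    rw [hpair] at hmem
    unfold topProj
    exact vecMulVec_eq_of_mem_pair hmem
  -- orthogonality `N′ ⊥ e`
  have h0 : N' ⬝ᵥ e = 0 := by
    have h := dotProduct_deriv_eq_zero_of_unit hN0' hunit
    rwa [hN0] at h
  -- entrywise derivatives of `L` at `0` and the eigenframe data (as in `TopEigDensityRForm`)
  have hA : ∀ i j, HasDerivAt (fun t => L t i j) (torusStrainMatrix (Torus.partialDeriv k v) x i j) 0 := by
    intro i j
    have h := hasDerivAt_coordLine (isSmooth_torusStrainMatrix_entry hv i j) x k 0
    rw [coordLine_zero, partialDeriv_strainEntry hv] at h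
    exact h
  have horth := KyFan.eigenvectorBasis_dotProduct (torusStrainMatrix_isHermitian v x)
  have hu : ∀ a, L 0 *ᵥ ((torusStrainMatrix_isHermitian v x).eigenvectorBasis a).ofLp =
      (torusStrainMatrix_isHermitian v x).eigenvalues a •
        ((torusStrainMatrix_isHermitian v x).eigenvectorBasis a).ofLp := by
    intro a; rw [hL0]; exact (torusStrainMatrix_isHermitian v x).mulVec_eigenvectorBasis a
  have hu₀ : ((torusStrainMatrix_isHermitian v x).eigenvectorBasis a₀).ofLp = N 0 := by rw [hN0]
  have horth' : ∀ a, a ≠ a₀ →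
      ((torusStrainMatrix_isHermitian v x).eigenvectorBasis a).ofLp ⬝ᵥ N 0 = 0 := by
    intro a ha
    rw [hN0, hedef, horth a a₀, if_neg ha]
  have hgapκ : ∀ a, a ≠ a₀ → (torusStrainMatrix_isHermitian v x).eigenvalues a ≠ Λ 0 := by
    intro a ha h
    have hle := eigenvalues_le_midEig_of_ne hx ha₀ ha
    rw [h, hΛ0] at hle
    linarith
  have hspan : ∀ y : Fin 3 → ℝ, y = ∑ a, (y ⬝ᵥ ((torusStrainMatrix_isHermitian v x).eigenvectorBasis a).ofLp) •
      ((torusStrainMatrix_isHermitian v x).eigenvectorBasis a).ofLp := by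
    intro y
    have h := KyFan.eq_sum_dotProduct_smul (torusStrainMatrix_isHermitian v x) y
    simp_rw [dotProduct_comm y]
    exact h
  have hnorm := norm_sq_deriv_eigenvector_eq_sum_frame hA hN0' (hLsymm 0) heig hunit hu hu₀ horth' hgapκ hspan
  rw [hN0, hΛ0] at hnorm
  refine ⟨N', fun i j => ?_, h0, hnorm⟩
  have hprod : HasDerivAt (fun t => N t i * N t j) (N' i * N 0 j + N 0 i * N' j) 0 :=
    (hN0' i).mul (hN0' j)
  rw [hN0] at hprod
  have hEq : (fun t : ℝ => topProj v (x + proj (t • K)) i j) =ᶠ[𝓝 (0 : ℝ)] fun t => N t i * N t j :=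
    hP.mono fun θ hθ => by
      show topProj v (x + proj (θ • K)) i j = N θ i * N θ j
      rw [hθ, Matrix.vecMulVec_apply]
  exact hprod.congr_of_eventuallyEq hEq

/-- **`∑ᵢⱼ (∂ₖ(P₁)ᵢⱼ(x))² = 2 ∑_{a≠a₀} (u_aᵀS(∂ₖv)(x)u₀)² / (λ₁(x) − κ_a)²`** at a point of `U_s` — the
squared Frobenius norm of the partial derivative of the top projector field. [ours] -/
theorem sum_sq_partialDeriv_topProj_eq (hv : Torus.IsSmooth v)
    {x : UnitAddTorus (Fin 3)} (hx : torusStrainMidEig v x < torusStrainTopEig v x) {a₀ : Fin 3}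
    (ha₀ : (torusStrainMatrix_isHermitian v x).eigenvalues a₀ = torusStrainTopEig v x) (k : Fin 3) :
    ∑ i, ∑ j, (Torus.partialDeriv k (fun y => topProj v y i j) x) ^ 2 =
      2 * ∑ a ∈ Finset.univ.erase a₀,
        ((((torusStrainMatrix_isHermitian v x).eigenvectorBasis a).ofLp ⬝ᵥ
            (torusStrainMatrix (Torus.partialDeriv k v) x *ᵥ
              ((torusStrainMatrix_isHermitian v x).eigenvectorBasis a₀).ofLp)) /
          (torusStrainTopEig v x - (torusStrainMatrix_isHermitian v x).eigenvalues a)) ^ 2 := by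
  obtain ⟨N', hder, h0, hnorm⟩ := hasDerivAt_topProj_coordLine hv hx ha₀ k
  obtain ⟨he1, -, -⟩ := gapForm_eigenvectorBasis hx ha₀
  have hpd : ∀ i j, Torus.partialDeriv k (fun y => topProj v y i j) x =
      N' i * ((torusStrainMatrix_isHermitian v x).eigenvectorBasis a₀).ofLp j +
        ((torusStrainMatrix_isHermitian v x).eigenvectorBasis a₀).ofLp i * N' j := fun i j =>
    (hder i j).deriv
  simp_rw [hpd]
  rw [sum_sq_projDeriv_eq he1 h0, hnorm]

/-- **Under a spectral gap the projector derivative is controlled by the `e₁`-column of `∇S`:** if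
`λ₁(x) − κ_a ≥ γ > 0` for every `a ≠ a₀` (on the top-gap class `λ₂ ≤ (1−η)λ₁`, `γ = ηλ₁(x)`), then
`∑ᵢⱼ (∂ₖ(P₁)ᵢⱼ(x))² ≤ 2γ⁻² ∑_{a≠a₀}(u_aᵀS(∂ₖv)u₀)² ≤ 2γ⁻² |S(∂ₖv)(x)u₀|²`. [ours] -/
theorem sum_sq_partialDeriv_topProj_le_of_gap (hv : Torus.IsSmooth v)
    {x : UnitAddTorus (Fin 3)} (hx : torusStrainMidEig v x < torusStrainTopEig v x) {a₀ : Fin 3}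
    (ha₀ : (torusStrainMatrix_isHermitian v x).eigenvalues a₀ = torusStrainTopEig v x) (k : Fin 3)
    {γ : ℝ} (hγ : 0 < γ)
    (hgapγ : ∀ a, a ≠ a₀ → γ ≤ torusStrainTopEig v x - (torusStrainMatrix_isHermitian v x).eigenvalues a) :
    ∑ i, ∑ j, (Torus.partialDeriv k (fun y => topProj v y i j) x) ^ 2 ≤
      2 * (γ ^ 2)⁻¹ *
        ((torusStrainMatrix (Torus.partialDeriv k v) x *ᵥ
            ((torusStrainMatrix_isHermitian v x).eigenvectorBasis a₀).ofLp) ⬝ᵥ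
          (torusStrainMatrix (Torus.partialDeriv k v) x *ᵥ
            ((torusStrainMatrix_isHermitian v x).eigenvectorBasis a₀).ofLp)) := by
  rw [sum_sq_partialDeriv_topProj_eq hv hx ha₀ k]
  set M := torusStrainMatrix (Torus.partialDeriv k v) x with hM
  set u : Fin 3 → Fin 3 → ℝ := fun a => ((torusStrainMatrix_isHermitian v x).eigenvectorBasis a).ofLp
    with hu
  -- termwise `(c/(λ₁−κ_a))² ≤ γ⁻² c²`, then complete the sum over `a` (Parseval)
  have hterm : ∀ a ∈ Finset.univ.erase a₀,
      ((u a ⬝ᵥ (M *ᵥ u a₀)) / (torusStrainTopEig v x - (torusStrainMatrix_isHermitian v x).eigenvalues a)) ^ 2 ≤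
        (γ ^ 2)⁻¹ * (u a ⬝ᵥ (M *ᵥ u a₀)) ^ 2 := by
    intro a ha
    have hne : a ≠ a₀ := (Finset.mem_erase.1 ha).1
    have hga := hgapγ a hne
    rw [div_pow, div_eq_mul_inv, mul_comm]
    refine mul_le_mul_of_nonneg_right ?_ (sq_nonneg _)
    exact inv_anti₀ (pow_pos hγ 2) (pow_le_pow_left₀ hγ.le hga 2)
  have hsum := Finset.sum_le_sum hterm
  have hpars : ∑ a ∈ Finset.univ.erase a₀, (u a ⬝ᵥ (M *ᵥ u a₀)) ^ 2 ≤ (M *ᵥ u a₀) ⬝ᵥ (M *ᵥ u a₀) := by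
    rw [← sum_sq_frame_eq_column_sq x M (u a₀), ← Finset.add_sum_erase _ _ (Finset.mem_univ a₀)]
    have := sq_nonneg (u a₀ ⬝ᵥ (M *ᵥ u a₀))
    linarith
  have hγ2 : 0 ≤ (γ ^ 2)⁻¹ := by positivity
  calc 2 * ∑ a ∈ Finset.univ.erase a₀,
        ((u a ⬝ᵥ (M *ᵥ u a₀)) / (torusStrainTopEig v x - (torusStrainMatrix_isHermitian v x).eigenvalues a)) ^ 2
      ≤ 2 * ∑ a ∈ Finset.univ.erase a₀, (γ ^ 2)⁻¹ * (u a ⬝ᵥ (M *ᵥ u a₀)) ^ 2 := by linarith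
    _ = 2 * (γ ^ 2)⁻¹ * ∑ a ∈ Finset.univ.erase a₀, (u a ⬝ᵥ (M *ᵥ u a₀)) ^ 2 := by
        rw [← Finset.mul_sum]; ring
    _ ≤ 2 * (γ ^ 2)⁻¹ * ((M *ᵥ u a₀) ⬝ᵥ (M *ᵥ u a₀)) :=
        mul_le_mul_of_nonneg_left hpars (by positivity)

end TopEig

end Summit.NavierStokesRegularity.FunctionalMining

end
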